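import Literature.AlgebraicGeometry.Frobenioids.DivisorialDescriptions
import Literature.AlgebraicGeometry.Frobenioids.BiratGerms
import HarnessLib

/-!
# Frobenioids I, Theorem 5.1 (i): `A`-pairs — bookkeeping, surjectivity, injectivity

Mochizuki, *The geometry of Frobenioids I: the general theory*, Kyushu J. Math. **62** (2008)
293–400, §5, Theorem 5.1 (i), kurims text p. 96 (statement), pp. 97–99 (proof)
[cite: MochizukiFrdI2008, Thm. 5.1 (i) pp.96-99].

First half of the discharge of the named statement `PreFrobenioid.Thm51i F A` of
`DivisorialDescriptions.lean` (abc-iut-L1-t5); the assembly `thm51i_holds` is in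
`DivisorialDescriptionsProofs.lean`. Here, for a Frobenioid `F : C → F_Φ` (of isotropic type where
stated):
* bookkeeping for the class `Φ(φ)⁻¹(Div ψ − Div φ)` and the object `(C, Base(φ) ∘ Base(ψ)⁻¹)` of an
  `A`-pair `(φ : B → A, ψ : B → C)` (Remark 1.1.1);
* every class of `Pic_Φ(A) = Φ^gp(A)/Φ^birat(A)` is the class of an `A`-pair — every element of `Φ^gp(A)`
  is a difference and Definition 1.3 (iii)(d) realises both entries (`exists_apair_cls_eq`);
* every class of `Pic_C(A)` is the class of an `A`-pair — Definition 1.3 (i)(b)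
  (`exists_apair_toIsomOver_eq`; "this map is a surjection", p. 98);
* `A`-pairs with the same class in `Pic_C(A)` have the same class in `Pic_Φ(A)` (p. 98 bottom – p. 99
  top): refine both first entries to a common pre-step `ω : E → A`; the two resulting pre-steps into
  `C'` are base-equivalent, so their difference is a birational germ at `C'`, which `Φ^birat`
  transports back to `A` (`mk_cls_eq_of_toIsomOver_eq`).
Theorems only; no statement of `DivisorialDescriptions.lean` is altered.
-/

namespace Literature.AlgebraicGeometry.Frobenioids

open CategoryTheory Opposite

universe w v v' u u'

namespace PreFrobenioid

variable {D : Type u} [Category.{v} D] {Φ : Dᵒᵖ ⥤ CommMonCat.{w}}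
  {C : Type u'} [Category.{v'} C] (F : C ⥤ ElemFrobenioid Φ)

/-! ### Bookkeeping for `A`-pairs -/

/-- `Base(ψ) ∘ (Base(φ) ∘ Base(ψ)⁻¹) = Base(φ)` for the structure isomorphism of the object
`(C, Base(φ) ∘ Base(ψ)⁻¹)` attached to an `A`-pair. [cite: MochizukiFrdI2008, Thm. 5.1 (i) p.96] -/
theorem APair.base_snd_comp_iso_hom {A : C} (p : APair F A) :
    Base F p.snd ≫ p.toIsomOver.iso.hom = Base F p.fst := by
  haveI : IsIso (Base F p.snd) := p.isPreStep_snd.2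
  haveI : IsIso (Base F p.fst) := p.isPreStep_fst.2
  show Base F p.snd ≫ (inv (Base F p.snd) ≫ Base F p.fst) = Base F p.fst
  rw [IsIso.hom_inv_id_assoc]

/-- `Base(φ) ∘ (Base(φ) ∘ Base(ψ)⁻¹)⁻¹ = Base(ψ)`. [cite: MochizukiFrdI2008, Thm. 5.1 (i) p.96] -/
theorem APair.base_fst_comp_iso_inv {A : C} (p : APair F A) :
    Base F p.fst ≫ p.toIsomOver.iso.inv = Base F p.snd := by
  rw [Iso.comp_inv_eq]
  exact (APair.base_snd_comp_iso_hom F p).symm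

/-- `Φ(φ)` applied to the class `Φ(φ)⁻¹(Div ψ − Div φ)` of an `A`-pair `(φ, ψ)` is `Div ψ − Div φ`.
[cite: MochizukiFrdI2008, Thm. 5.1 (i) p.96] -/
theorem APair.pullGp_cls {A : C} (p : APair F A) :
    pullGp Φ (Base F p.fst) p.cls =
      Algebra.GrothendieckGroup.of (Div F p.snd) / Algebra.GrothendieckGroup.of (Div F p.fst) := by
  haveI : IsIso (Base F p.fst) := p.isPreStep_fst.2
  show pullGp Φ (Base F p.fst) (Algebra.GrothendieckGroup.of (pull Φ (inv (Base F p.fst)) (Div F p.snd)) /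
    Algebra.GrothendieckGroup.of (pull Φ (inv (Base F p.fst)) (Div F p.fst))) = _
  rw [map_div, pullGp_of', pullGp_of', pull_pull_inv_eq, pull_pull_inv_eq]

/-- Divisors after refining an `A`-pair `(φ : B → A, ψ : B → C)` by a base-isomorphism `η : E → B`:
`Div(ψ ∘ η) = Φ(φ ∘ η)(class) + Div(φ ∘ η)` in `Φ^gp(E_D)` (Remark 1.1.1).
[cite: MochizukiFrdI2008, Thm. 5.1 (i) p.97] -/
theorem APair.of_div_comp_snd {A : C} (p : APair F A) {E : C} (η : E ⟶ p.src) :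
    Algebra.GrothendieckGroup.of (Div F (η ≫ p.snd)) =
      pullGp Φ (Base F (η ≫ p.fst)) p.cls * Algebra.GrothendieckGroup.of (Div F (η ≫ p.fst)) := by
  rw [div_comp, div_comp, degFr_coe_eq_one F p.isPreStep_snd.1, degFr_coe_eq_one F p.isPreStep_fst.1,
    pow_one, base_comp, pullGp_comp, APair.pullGp_cls, map_div, pullGp_of', pullGp_of',
    map_mul, map_mul, ← mul_assoc, div_mul_cancel]

/-- The class transported to `C`: for a base-isomorphism `η : E → B`,
`Φ(ψ)((Φ(ψ ∘ η))⁻¹ Div(ψ ∘ η)) = Φ(φ)(class + (Φ(φ ∘ η))⁻¹ Div(φ ∘ η))` in `Φ^gp(B_D)` (both sides equal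
`Div ψ + Φ(η)⁻¹ Div η`; Remark 1.1.1). [cite: MochizukiFrdI2008, Thm. 5.1 (i) p.97] -/
theorem APair.pullGp_snd_of_invDiv {A : C} (p : APair F A) {E : C} (η : E ⟶ p.src)
    (hη : IsBaseIso F η) (h : IsBaseIso F (η ≫ p.snd)) (h' : IsBaseIso F (η ≫ p.fst)) :
    pullGp Φ (Base F p.snd) (Algebra.GrothendieckGroup.of (invDiv F (η ≫ p.snd) h)) =
      pullGp Φ (Base F p.fst) (p.cls * Algebra.GrothendieckGroup.of (invDiv F (η ≫ p.fst) h')) := by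
  rw [pullGp_of', pull_invDiv_comp F η p.snd hη p.isPreStep_snd h, map_mul Algebra.GrothendieckGroup.of,
    map_mul (pullGp Φ (Base F p.fst)), APair.pullGp_cls, pullGp_of',
    pull_invDiv_comp F η p.fst hη p.isPreStep_fst h', map_mul, ← mul_assoc, div_mul_cancel]

/-! ### Surjectivity onto `Pic_Φ(A)` and onto `Pic_C(A)` -/

/-- Every element of a Grothendieck group is a difference of two elements of the monoid.
[cite: MochizukiFrdI2008, §0 p.10] -/
theorem exists_eq_of_div_of {M : Type*} [CommMonoid M] (g : Algebra.GrothendieckGroup M) :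
    ∃ x y : M, g = Algebra.GrothendieckGroup.of x / Algebra.GrothendieckGroup.of y := by
  induction g using Localization.induction_on with
  | H q =>
    refine ⟨q.1, q.2, eq_div_iff_mul_eq'.mpr ?_⟩
    show Localization.mk q.1 q.2 * Localization.mk (q.2 : M) 1 = Localization.mk q.1 1
    rw [Localization.mk_mul, Localization.mk_eq_mk_iff, Localization.r_iff_exists]
    exact ⟨1, by simp [mul_comm]⟩

/-- Every element of `Φ^gp(A_D)` is the class `Φ(φ)⁻¹(Div ψ − Div φ)` of an `A`-pair: realise the two
entries by Definition 1.3 (iii)(d) (slice over `A` for `φ`, coslice under `B` for `ψ`).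
[cite: MochizukiFrdI2008, Thm. 5.1 (i) p.97] -/
theorem exists_apair_cls_eq (hF : IsFrobenioid F) (A : C)
    (g : Algebra.GrothendieckGroup (Φ.obj (op (baseObj F A)))) : ∃ p : APair F A, p.cls = g := by
  obtain ⟨y, x, rfl⟩ := exists_eq_of_div_of g
  obtain ⟨B, φ, hφ, hφx⟩ := hF.iii_d_over_surj A x
  haveI : IsIso (Base F φ) := hφ.2.2
  obtain ⟨C', ψ, hψ, hψy⟩ := hF.iii_d_under_surj B (pull Φ (Base F φ) y)
  refine ⟨⟨B, C', φ, ψ, hφ.2, hψ.2⟩, ?_⟩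
  show Algebra.GrothendieckGroup.of (pull Φ (inv (Base F φ)) (Div F ψ)) /
      Algebra.GrothendieckGroup.of (pull Φ (inv (Base F φ)) (Div F φ)) = _
  rw [hψy, pull_inv_pull_eq]
  exact congrArg _ (congrArg _ hφx)

/-- Every object `(C, ζ)` of `C ×_D D^isom_{A_D}` is isomorphic to the object attached to an `A`-pair
("It follows immediately from Definition 1.3, (i), (b), that this map is a surjection", p. 98).
[cite: MochizukiFrdI2008, Thm. 5.1 (i) p.98] -/
theorem exists_apair_toIsomOver_eq (hF : IsFrobenioid F) (A : C) (c : PicC F (baseObj F A)) :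
    ∃ p : APair F A, (⟦p.toIsomOver⟧ : PicC F (baseObj F A)) = c := by
  induction c using Quotient.ind with
  | _ X =>
    obtain ⟨Y, φ, ψ, hφ, hψ, h⟩ := hF.i_b A X.obj X.iso.symm
    haveI : IsIso (Base F ψ) := hψ.2
    haveI : IsIso (Base F φ) := hφ.2
    refine ⟨⟨Y, X.obj, φ, ψ, hφ, hψ⟩, Quotient.sound ⟨Iso.refl X.obj, ?_⟩⟩
    show Base F (𝟙 X.obj) ≫ X.iso.hom = inv (Base F ψ) ≫ Base F φ
    rw [base_id, Category.id_comp, IsIso.eq_inv_comp, ← h, Iso.symm_hom, Category.assoc,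
      Iso.inv_hom_id, Category.comp_id]

/-! ### Same class in `Pic_C(A)` ⟹ same class in `Pic_Φ(A)` -/

/-- If the objects attached to two `A`-pairs `p = (φ, ψ)`, `q = (φ', ψ')` are isomorphic over `A_D`,
then the difference of their classes lies in `Φ^birat(A_D)` (proof of Thm. 5.1 (i), injectivity,
p. 98 bottom – p. 99): refine `φ, φ'` to a common pre-step `ω : E → A`; the refined second entries
are base-equivalent pre-steps into `C`, whose difference is a birational germ at `C`.
[cite: MochizukiFrdI2008, Thm. 5.1 (i) p.99] -/
theorem cls_div_cls_mem_of_isIsomorphic (hF : IsFrobenioid F) (hiso : IsOfIsotropicType F) {A : C}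
    (p q : APair F A) (h : IsomOver.IsIsomorphic p.toIsomOver q.toIsomOver) :
    p.cls / q.cls ∈ (biratSubfunctor F).carrier (baseObj F A) := by
  haveI : IsIso (Base F p.fst) := p.isPreStep_fst.2
  haveI : IsIso (Base F q.fst) := q.isPreStep_fst.2
  haveI : IsIso (Base F p.snd) := p.isPreStep_snd.2
  haveI : IsIso (Base F q.snd) := q.isPreStep_snd.2
  obtain ⟨k, hk⟩ : ∃ k : p.tgt ≅ q.tgt,
      Base F k.hom ≫ q.toIsomOver.iso.hom = p.toIsomOver.iso.hom := h
  have hkraw : Base F k.hom ≫ (inv (Base F q.snd) ≫ Base F q.fst) = inv (Base F p.snd) ≫ Base F p.fst :=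
    hk
  have hk' : Base F p.snd ≫ Base F k.hom ≫ inv (Base F q.snd) ≫ Base F q.fst = Base F p.fst := by
    rw [hkraw, IsIso.hom_inv_id_assoc]
  have hf : inv (Base F q.fst) ≫ Base F q.snd = inv (Base F p.fst) ≫ Base F p.snd ≫ Base F k.hom := by
    rw [IsIso.eq_inv_comp, ← hk']
    simp only [Category.assoc, IsIso.hom_inv_id_assoc, IsIso.inv_hom_id, Category.comp_id]
  -- common refinement of `φ = p.fst` and `φ' = q.fst`
  obtain ⟨E, ω, hω, hωdiv⟩ := hF.iii_d_over_surj A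
    (invDiv F p.fst p.isPreStep_fst.2 * invDiv F q.fst q.isPreStep_fst.2)
  obtain ⟨η, hη, hηω⟩ := hF.iii_d_over_full ω p.fst hω
    (isCoAngularPreStep_of_isotropic hiso p.isPreStep_fst) (by rw [hωdiv]; exact dvd_mul_right _ _)
  obtain ⟨η', hη', hη'ω⟩ := hF.iii_d_over_full ω q.fst hω
    (isCoAngularPreStep_of_isotropic hiso q.isPreStep_fst) (by rw [hωdiv]; exact dvd_mul_left _ _)
  -- the two base-equivalent pre-steps `E → C'` (`C' = q.tgt`)
  have he₀ : IsPreStep F (η ≫ p.snd) := IsPreStep.comp F hη.2 p.isPreStep_snd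
  have he : IsPreStep F ((η ≫ p.snd) ≫ k.hom) := IsPreStep.comp F he₀ (isPreStep_of_isIso F _)
  have he' : IsPreStep F (η' ≫ q.snd) := IsPreStep.comp F hη'.2 q.isPreStep_snd
  have hbase₀ : Base F η ≫ Base F p.snd ≫ Base F k.hom = Base F η' ≫ Base F q.snd := by
    rw [← cancel_mono (inv (Base F q.snd) ≫ Base F q.fst), Category.assoc, Category.assoc, hk',
      ← base_comp, hηω, ← hη'ω, base_comp, Category.assoc, IsIso.hom_inv_id_assoc]
  have hbe : BaseEquivalent F ((η ≫ p.snd) ≫ k.hom) (η' ≫ q.snd) := by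
    show Base F ((η ≫ p.snd) ≫ k.hom) = Base F (η' ≫ q.snd)
    rw [base_comp, base_comp, base_comp, Category.assoc, hbase₀]
  have hgerm := div_invDiv_mem_biratSubfunctor F ((η ≫ p.snd) ≫ k.hom) (η' ≫ q.snd)
    (isCoAngularPreStep_of_isotropic hiso he) he' hbe
  have hmem := (biratSubfunctor F).pull_mem (inv (Base F q.fst) ≫ Base F q.snd) hgerm
  -- identify the transported germ with `p.cls / q.cls`
  have hωp : invDiv F (η ≫ p.fst) (IsBaseIso.comp F hη.2.2 p.isPreStep_fst.2) = invDiv F ω hω.2.2 :=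
    RatFrac.invDiv_congr F hηω _ _
  have hωq : invDiv F (η' ≫ q.fst) (IsBaseIso.comp F hη'.2.2 q.isPreStep_fst.2) = invDiv F ω hω.2.2 :=
    RatFrac.invDiv_congr F hη'ω _ _
  have h1 : pullGp Φ (inv (Base F q.fst) ≫ Base F q.snd)
      (Algebra.GrothendieckGroup.of (invDiv F ((η ≫ p.snd) ≫ k.hom) he.2)) =
      p.cls * Algebra.GrothendieckGroup.of (invDiv F ω hω.2.2) := by
    rw [hf, pullGp_comp, pullGp_comp, pullGp_of',
      pull_invDiv_comp F (η ≫ p.snd) k.hom he₀.2 (isPreStep_of_isIso F _) he.2,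
      show Div F k.hom = 1 from isIsometry_of_isIso F hF.isPreFrobenioid _, one_mul,
      APair.pullGp_snd_of_invDiv F p η hη.2.2 he₀.2 (IsBaseIso.comp F hη.2.2 p.isPreStep_fst.2),
      pullGp_inv_pullGp, hωp]
  have h2 : pullGp Φ (inv (Base F q.fst) ≫ Base F q.snd)
      (Algebra.GrothendieckGroup.of (invDiv F (η' ≫ q.snd) he'.2)) =
      q.cls * Algebra.GrothendieckGroup.of (invDiv F ω hω.2.2) := by
    rw [pullGp_comp, APair.pullGp_snd_of_invDiv F q η' hη'.2.2 he'.2 (IsBaseIso.comp F hη'.2.2 q.isPreStep_fst.2),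
      pullGp_inv_pullGp, hωq]
  rw [map_div, h1, h2, mul_div_mul_right_eq_div] at hmem
  exact hmem

/-- Same class in `Pic_C(A)` ⟹ same class in `Pic_Φ(A)`. [cite: MochizukiFrdI2008, Thm. 5.1 (i) p.99] -/
theorem mk_cls_eq_of_toIsomOver_eq (hF : IsFrobenioid F) (hiso : IsOfIsotropicType F) {A : C}
    {p q : APair F A} (h : (⟦p.toIsomOver⟧ : PicC F (baseObj F A)) = ⟦q.toIsomOver⟧) :
    (QuotientGroup.mk p.cls : (biratSubfunctor F).Pic (baseObj F A)) = QuotientGroup.mk q.cls :=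
  QuotientGroup.eq_iff_div_mem.mpr (cls_div_cls_mem_of_isIsomorphic F hF hiso p q (Quotient.exact h))

end PreFrobenioid

end Literature.AlgebraicGeometry.Frobenioids
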